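import Summits.AtomisticToContinuum.FouriersLaw.Theorems.EmbeddedDrudeMourreNessUniqueTruncation

/-!
# Uniqueness of the weak steady state (`NessUnique`), part 4: the `L¹` bound on the stationary defect

Support file for item `stmt-AtomisticToContinuum-0741` (`EmbeddedDrudeMourre.NessUnique`). For smooth confining
potentials, `N ≥ 1`, `T_L, T_R ≥ 0`, and a `C²` integrable solution `ρ ≥ 0` of `L̂ρ + 2γρ = 0`, the defect of the
truncations `f_{R,M} = χ(H/R) m_M(ρ)` obeys `∫ |L̂ f + 2γ f| ≤ K₀ ∫ θ_M(ρ) + K₃ ∫_{R ≤ H} ρ + (K₄/√R)[ε W (m₀ + δ V) + m₀/ε]`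
(`integral_abs_defect_le`; `θ_M(s) = s[M < s]`, `m₀ = ∫ρ`, `V = |{H ≤ 4R}|`, `W = 1 + arsinh²(2M/δ)`): height terms via
the entropy-type identity with `F = s - m_M(s)`, cutoff term via `|L̂ χ(H/R)| ≤ K 1_{R ≤ H}`, cross term
`m_M'(ρ) Γ(χ(H/R), ρ)` via `|Dχ(H/R)·v_b| ≤ C/√R` on the shell, AM–GM and the weighted Fisher bound with `F_δ`.
-/

noncomputable section

open MeasureTheory ProbabilityTheory Filter Topology Set
open scoped ContDiff NNReal ENNReal

namespace Summit.AtomisticToContinuum.FouriersLaw.Theorems.NessUnique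

open Literature.MathematicalPhysics.KineticTheory.HeatConduction
open Literature.MathematicalPhysics.KineticTheory Literature.Probability.Process OscillatorChain
open Literature.Analysis.Distribution
open Summit.AtomisticToContinuum.FouriersLaw.Theorems.SubdiffusiveBondHeat

variable {N : ℕ} {P : OscillatorChain}

/-! ### Continuity and support of carré-du-champ terms -/

/-- `Γ(f, g)` is continuous for `C²` (indeed `C¹`) `f, g`. [folklore] -/
theorem continuous_carreDuChamp (v₁ v₂ : PhaseSpace N) {f g : PhaseSpace N → ℝ} (hf : ContDiff ℝ 2 f)
    (hg : ContDiff ℝ 2 g) : Continuous (carreDuChamp v₁ v₂ f g) := by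
  have hfc : Continuous (fderiv ℝ f) := hf.continuous_fderiv (by norm_num)
  have hgc : Continuous (fderiv ℝ g) := hg.continuous_fderiv (by norm_num)
  rw [show carreDuChamp v₁ v₂ f g = _ from funext fun y => carreDuChamp_def v₁ v₂ f g y]
  exact ((hfc.clm_apply continuous_const).mul (hgc.clm_apply continuous_const)).add
    ((hfc.clm_apply continuous_const).mul (hgc.clm_apply continuous_const))

/-- `Γ(f, g)` has compact support if `f` has. [folklore] -/
theorem hasCompactSupport_carreDuChamp (v₁ v₂ : PhaseSpace N) {f : PhaseSpace N → ℝ}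
    (hfc : HasCompactSupport f) (g : PhaseSpace N → ℝ) : HasCompactSupport (carreDuChamp v₁ v₂ f g) := by
  rw [show carreDuChamp v₁ v₂ f g = _ from funext fun y => carreDuChamp_def v₁ v₂ f g y]
  exact ((hfc.fderiv_apply (𝕜 := ℝ) v₁).mul_right).add ((hfc.fderiv_apply (𝕜 := ℝ) v₂).mul_right)

section Defect

variable (hU : ContDiff ℝ ((⊤ : ℕ∞) : WithTop ℕ∞) P.U)
  (hV : ContDiff ℝ ((⊤ : ℕ∞) : WithTop ℕ∞) P.V) (hN : 0 < N) {T_L T_R : ℝ}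
  (hTL : 0 ≤ T_L) (hTR : 0 ≤ T_R) {ρ : PhaseSpace N → ℝ} (hρ : ContDiff ℝ 2 ρ) (hρ0 : ∀ x, 0 ≤ ρ x)
  (hρi : Integrable ρ)
  (hpde : ∀ x, sdeGenerator (fun y => -P.drift N y) (P.bathVecL N T_L) (P.bathVecR N T_R) ρ x +
    2 * P.γ * ρ x = 0)

include hU hV hN hρ hρ0 hρi hpde in
/-- **The height terms**: `½ ∫ χ(H/R) (-m_M''(ρ)) Γ(ρ,ρ) ≤ (K + 2γ) ∫ θ_M(ρ)` whenever `|L χ(H/R)| ≤ K`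
(entropy-type identity with `F(s) = s - m_M(s)`, `0 ≤ F, sF' - F ≤ θ_M`). [folklore] -/
theorem half_integral_height_le (hP : P.IsConfining) {M R K : ℝ} (hM : 0 < M) (hR : 0 < R)
    (hK : ∀ x, |sdeGenerator (P.drift N) (P.bathVecL N T_L) (P.bathVecR N T_R)
      (fun y => smoothCutoff (P.hamiltonian N y / R)) x| ≤ K) :
    (1 / 2) * ∫ x, smoothCutoff (P.hamiltonian N x / R) * (-(deriv smoothCutoff (ρ x / M) / M) *
        carreDuChamp (P.bathVecL N T_L) (P.bathVecR N T_R) ρ ρ x) ≤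
      1 * (K + 2 * P.γ) * ∫ x, (if M < ρ x then ρ x else 0) := by
  have hU2 : ContDiff ℝ 2 P.U := hU.of_le (by norm_cast)
  have hV2 : ContDiff ℝ 2 P.V := hV.of_le (by norm_cast)
  have hF : ∀ u : ℝ, HasDerivAt (fun s => s - ∫ σ in (0:ℝ)..s, smoothCutoff (σ / M))
      (1 - smoothCutoff (u / M)) u := fun u => (hasDerivAt_id u).sub (hasDerivAt_heightProfile M u)
  have hF' : ∀ u : ℝ, HasDerivAt (fun s => 1 - smoothCutoff (s / M))
      (-(deriv smoothCutoff (u / M) / M)) u := fun u => (hasDerivAt_cutoffProfile M u).const_sub 1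
  have hF'' : Continuous fun u : ℝ => -(deriv smoothCutoff (u / M) / M) :=
    ((((contDiff_smoothCutoff (n := 1)).continuous_deriv le_rfl).comp (continuous_id.div_const M)).div_const M).neg
  have hθ : Integrable fun x => (if M < ρ x then ρ x else 0) := by
    have e : (fun x => (if M < ρ x then ρ x else 0)) = {x | M < ρ x}.indicator ρ := by
      funext x; simp only [Set.indicator_apply, Set.mem_setOf_eq]
    rw [e]
    exact hρi.indicator (measurableSet_lt measurable_const hρ.continuous.measurable)
  refine half_integral_weightedFisher_le P hU hV hN hP.γ_nonneg T_L T_R hρ hρ0 hpde hF hF' hF''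
    (θ := fun s => if M < s then s else 0) (ℓ := 1)
    (fun s hs => (sub_heightProfile_bounds hM hs).1) (fun s hs => (sub_heightProfile_bounds hM hs).2.1)
    (fun s hs => (sub_heightProfile_bounds hM hs).2.2.1) (fun s hs => (sub_heightProfile_bounds hM hs).2.2.2)
    hθ (contDiff_energyCutoff hU2 hV2 N R) (hasCompactSupport_energyCutoff hP N hR)
    (fun x => (energyCutoff_mem_Icc (P := P) R x).2) hK

include hρ0 in
/-- **The cutoff term**, pointwise: if `|L̂ χ(H/R)| ≤ K` and `L̂ χ(H/R) = 0` off `{R ≤ H ≤ 2R}`, then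
`ρ |L̂ χ(H/R)| ≤ K · 1_{R ≤ H} ρ`. [folklore] -/
theorem mul_abs_revGenerator_cutoff_le {R K : ℝ}
    (hK : ∀ x, |sdeGenerator (fun y => -P.drift N y) (P.bathVecL N T_L) (P.bathVecR N T_R)
      (fun y => smoothCutoff (P.hamiltonian N y / R)) x| ≤ K ∧
      (¬ (R ≤ P.hamiltonian N x ∧ P.hamiltonian N x ≤ 2 * R) →
        sdeGenerator (fun y => -P.drift N y) (P.bathVecL N T_L) (P.bathVecR N T_R)
          (fun y => smoothCutoff (P.hamiltonian N y / R)) x = 0)) (x : PhaseSpace N) :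
    ρ x * |sdeGenerator (fun y => -P.drift N y) (P.bathVecL N T_L) (P.bathVecR N T_R)
        (fun y => smoothCutoff (P.hamiltonian N y / R)) x| ≤
      K * {x | R ≤ P.hamiltonian N x}.indicator ρ x := by
  by_cases h : R ≤ P.hamiltonian N x
  · rw [Set.indicator_of_mem (show x ∈ {x | R ≤ P.hamiltonian N x} from h), mul_comm]
    exact mul_le_mul_of_nonneg_right (hK x).1 (hρ0 x)
  · rw [(hK x).2 (fun hc => h hc.1), abs_zero, mul_zero,
      Set.indicator_of_notMem (show x ∉ {x | R ≤ P.hamiltonian N x} from h), mul_zero]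

/-- **AM–GM on the shell**, pointwise: with `m' = χ(·/M) ∈ [0,1]` vanishing on `[2M, ∞)` and
`W = 1 + arsinh²(2M/δ)`, for every `y`:
`χ(s/M) |y| ≤ ½ (ε W (s + δ) + F_δ''(s) y²/ε)` (`s ≥ 0`). [folklore] -/
theorem deriv_height_mul_abs_le {M δ ε s : ℝ} (hM : 0 < M) (hδ : 0 < δ) (hε : 0 < ε) (hs : 0 ≤ s)
    (y : ℝ) :
    smoothCutoff (s / M) * |y| ≤
      (ε * ((1 + Real.arsinh (2 * M / δ) ^ 2) * (s + δ)) +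
        (1 / (1 + Real.arsinh (s / δ) ^ 2) * ((Real.sqrt (1 + (s / δ) ^ 2))⁻¹ * (1 / δ))) * y ^ 2 / ε) / 2 := by
  have hrhs0 : 0 ≤ (ε * ((1 + Real.arsinh (2 * M / δ) ^ 2) * (s + δ)) +
      (1 / (1 + Real.arsinh (s / δ) ^ 2) * ((Real.sqrt (1 + (s / δ) ^ 2))⁻¹ * (1 / δ))) * y ^ 2 / ε) / 2 := by
    have := fisherCurv_pos hδ s
    positivity
  by_cases h2M : s < 2 * M
  · calc smoothCutoff (s / M) * |y| ≤ 1 * |y| :=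
          mul_le_mul_of_nonneg_right (smoothCutoff_le_one _) (abs_nonneg y)
      _ ≤ _ := by rw [one_mul]; exact abs_le_amgm_fisherCurv hδ hs h2M.le hε y
  · rw [deriv_heightProfile_eq_zero hM (not_lt.1 h2M), zero_mul]
    exact hrhs0

include hU hV hN hρ hρ0 hρi hpde in
/-- **The cross term.** For `R ≥ 1`, `M, δ, ε > 0` (with the constants `K₁` of `|L χ(H/2R)| ≤ K₁` and `C` of
`|Dχ(H/R)·bathVec| ≤ C|c|/√R`):
`∫ χ(ρ/M) |Γ(χ(H/R), ρ)| ≤ (C(c_L+c_R)/√R) [ε W (m₀ + δ |{H ≤ 4R}|) + (π/2)(K₁ + 2γ) m₀/ε]`,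
`c_b = √(2γT_b)`, `m₀ = ∫ρ`, `W = 1 + arsinh²(2M/δ)`. [folklore] -/
theorem integral_cross_le (hP : P.IsConfining) {K₁ C : ℝ} (hK₁ : ∀ R : ℝ, 1 ≤ R → ∀ x,
      |sdeGenerator (P.drift N) (P.bathVecL N T_L) (P.bathVecR N T_R)
        (fun y => smoothCutoff (P.hamiltonian N y / R)) x| ≤ K₁)
    (hC0 : 0 ≤ C) (hC : ∀ R : ℝ, 1 ≤ R → ∀ (x : PhaseSpace N) {k : ℕ} (hk : k < N) (c : ℝ),
      |fderiv ℝ (fun y => smoothCutoff (P.hamiltonian N y / R)) x (bathVec N k c)| ≤ C * |c| / Real.sqrt R ∧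
      (¬ (R ≤ P.hamiltonian N x ∧ P.hamiltonian N x ≤ 2 * R) →
        fderiv ℝ (fun y => smoothCutoff (P.hamiltonian N y / R)) x (bathVec N k c) = 0))
    {R M δ ε : ℝ} (hR : 1 ≤ R) (hM : 0 < M) (hδ : 0 < δ) (hε : 0 < ε) :
    ∫ x, smoothCutoff (ρ x / M) *
        |carreDuChamp (P.bathVecL N T_L) (P.bathVecR N T_R) (fun y => smoothCutoff (P.hamiltonian N y / R)) ρ x| ≤
      C * (|Real.sqrt (2 * P.γ * T_L)| + |Real.sqrt (2 * P.γ * T_R)|) / Real.sqrt R *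
        (ε * (1 + Real.arsinh (2 * M / δ) ^ 2) *
            ((∫ x, ρ x) + δ * (volume {x | P.hamiltonian N x ≤ 4 * R}).toReal) +
          Real.pi / 2 * (K₁ + 2 * P.γ) * (∫ x, ρ x) / ε) := by
  have hU2 : ContDiff ℝ 2 P.U := hU.of_le (by norm_cast)
  have hV2 : ContDiff ℝ 2 P.V := hV.of_le (by norm_cast)
  have hR0 : 0 < R := by linarith
  have h2R : 1 ≤ 2 * R := by linarith
  have h2R0 : 0 < 2 * R := by linarith
  set vL := P.bathVecL N T_L with hvL
  set vR := P.bathVecR N T_R with hvR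
  set cL := Real.sqrt (2 * P.γ * T_L)
  set cR := Real.sqrt (2 * P.γ * T_R)
  set a : PhaseSpace N → ℝ := fun y => smoothCutoff (P.hamiltonian N y / R) with ha
  set ah : PhaseSpace N → ℝ := fun y => smoothCutoff (P.hamiltonian N y / (2 * R)) with hah
  set W := 1 + Real.arsinh (2 * M / δ) ^ 2 with hW
  set Fc : ℝ → ℝ := fun s => 1 / (1 + Real.arsinh (s / δ) ^ 2) * ((Real.sqrt (1 + (s / δ) ^ 2))⁻¹ * (1 / δ))
    with hFc
  set Γρ := carreDuChamp vL vR ρ ρ with hΓρ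
  set sh : Set (PhaseSpace N) := {x | R ≤ P.hamiltonian N x ∧ P.hamiltonian N x ≤ 2 * R} with hsh
  set Cc := C * (|cL| + |cR|) with hCc
  have hCc0 : 0 ≤ Cc := by positivity
  have hW1 : 1 ≤ W := by rw [hW]; nlinarith [sq_nonneg (Real.arsinh (2 * M / δ))]
  have hρc : Continuous ρ := hρ.continuous
  have hρm : Measurable ρ := hρc.measurable
  have hHc : Continuous (P.hamiltonian N) := (P.contDiff_hamiltonian hU2 hV2 N).continuous
  have hsh_meas : MeasurableSet sh :=
    (measurableSet_le measurable_const hHc.measurable).inter (measurableSet_le hHc.measurable measurable_const)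
  have hsh_sub : sh ⊆ {x | P.hamiltonian N x ≤ 4 * R} := fun x hx => by
    simp only [Set.mem_setOf_eq] at hx ⊢; linarith [hx.2]
  have hV4 : volume {x | P.hamiltonian N x ≤ 4 * R} < (⊤ : ℝ≥0∞) :=
    (hP.isCompact_setOf_hamiltonian_le N (4 * R)).measure_lt_top
  have hVsh : volume sh < (⊤ : ℝ≥0∞) := (measure_mono hsh_sub).trans_lt hV4
  set Φ : PhaseSpace N → ℝ := fun x =>
    Cc / Real.sqrt R * (sh.indicator (fun x => ε * W * (ρ x + δ)) x + ah x * (Fc (ρ x) * Γρ x) / (2 * ε))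
    with hΦ
  have hFc0 : ∀ s, 0 < Fc s := fun s => fisherCurv_pos hδ s
  have hΓρ0 : ∀ x, 0 ≤ Γρ x := fun x => carreDuChamp_self_nonneg vL vR ρ x
  have hah_mem : ∀ x, ah x ∈ Icc (0:ℝ) 1 := fun x => energyCutoff_mem_Icc (P := P) (2 * R) x
  have hpt : ∀ x, smoothCutoff (ρ x / M) * |carreDuChamp vL vR a ρ x| ≤ Φ x := by
    intro x
    have hDa : ∀ (k : ℕ) (hk : k < N) (c : ℝ), |fderiv ℝ a x (bathVec N k c)| ≤ C * |c| / Real.sqrt R ∧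
        (x ∉ sh → fderiv ℝ a x (bathVec N k c) = 0) := fun k hk c => hC R hR x hk c
    have hN1 : N - 1 < N := Nat.sub_lt hN one_pos
    have evL : vL = bathVec N 0 cL := rfl
    have evR : vR = bathVec N (N - 1) cR := rfl
    have hL := hDa 0 hN cL
    have hRt := hDa (N - 1) hN1 cR
    rw [← evL] at hL
    rw [← evR] at hRt
    rw [carreDuChamp_def]
    by_cases hx : x ∈ sh
    · -- on the shell
      rw [hΦ]; dsimp only
      rw [Set.indicator_of_mem hx]
      have hm := fun y : ℝ => deriv_height_mul_abs_le hM hδ hε (hρ0 x) y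
      have h1 : smoothCutoff (ρ x / M) * |fderiv ℝ a x vL * fderiv ℝ ρ x vL + fderiv ℝ a x vR * fderiv ℝ ρ x vR| ≤
          (Cc / Real.sqrt R) * (smoothCutoff (ρ x / M) * |fderiv ℝ ρ x vL| +
            smoothCutoff (ρ x / M) * |fderiv ℝ ρ x vR|) := by
        have hm0 : 0 ≤ smoothCutoff (ρ x / M) := smoothCutoff_nonneg _
        have hbL : |fderiv ℝ a x vL| ≤ Cc / Real.sqrt R := by
          refine hL.1.trans ?_
          rw [hCc]; apply div_le_div_of_nonneg_right _ (Real.sqrt_nonneg _)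
          nlinarith [abs_nonneg cL, abs_nonneg cR]
        have hbR : |fderiv ℝ a x vR| ≤ Cc / Real.sqrt R := by
          refine hRt.1.trans ?_
          rw [hCc]; apply div_le_div_of_nonneg_right _ (Real.sqrt_nonneg _)
          nlinarith [abs_nonneg cL, abs_nonneg cR]
        calc smoothCutoff (ρ x / M) * |fderiv ℝ a x vL * fderiv ℝ ρ x vL + fderiv ℝ a x vR * fderiv ℝ ρ x vR|
            ≤ smoothCutoff (ρ x / M) * (|fderiv ℝ a x vL| * |fderiv ℝ ρ x vL| +
                |fderiv ℝ a x vR| * |fderiv ℝ ρ x vR|) := by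
              refine mul_le_mul_of_nonneg_left ((abs_add_le _ _).trans ?_) hm0
              rw [abs_mul, abs_mul]
          _ ≤ smoothCutoff (ρ x / M) * ((Cc / Real.sqrt R) * |fderiv ℝ ρ x vL| +
                (Cc / Real.sqrt R) * |fderiv ℝ ρ x vR|) := by
              refine mul_le_mul_of_nonneg_left (add_le_add ?_ ?_) hm0
              · exact mul_le_mul_of_nonneg_right hbL (abs_nonneg _)
              · exact mul_le_mul_of_nonneg_right hbR (abs_nonneg _)
          _ = _ := by ring
      refine h1.trans ?_
      have hCR : 0 ≤ Cc / Real.sqrt R := div_nonneg hCc0 (Real.sqrt_nonneg _)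
      refine mul_le_mul_of_nonneg_left ?_ hCR
      have hA := hm (fderiv ℝ ρ x vL)
      have hB := hm (fderiv ℝ ρ x vR)
      have hah1 : ah x = 1 := energyCutoff_eq_one h2R0 hx.2
      rw [hah1, one_mul, hΓρ, carreDuChamp_self]
      have e : (ε * ((1 + Real.arsinh (2 * M / δ) ^ 2) * (ρ x + δ)) + Fc (ρ x) * fderiv ℝ ρ x vL ^ 2 / ε) / 2 +
          (ε * ((1 + Real.arsinh (2 * M / δ) ^ 2) * (ρ x + δ)) + Fc (ρ x) * fderiv ℝ ρ x vR ^ 2 / ε) / 2 =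
          ε * W * (ρ x + δ) + Fc (ρ x) * (fderiv ℝ ρ x vL ^ 2 + fderiv ℝ ρ x vR ^ 2) / (2 * ε) := by
        rw [hW]; field_simp; ring
      linarith [hA, hB, e.le, e.ge]
    · -- off the shell both bath derivatives of the cutoff vanish
      rw [hL.2 hx, hRt.2 hx]
      simp only [zero_mul, add_zero, abs_zero, mul_zero]
      rw [hΦ]; dsimp only
      rw [Set.indicator_of_notMem hx, zero_add]
      have : 0 ≤ ah x * (Fc (ρ x) * Γρ x) / (2 * ε) :=
        div_nonneg (mul_nonneg (hah_mem x).1 (mul_nonneg (hFc0 _).le (hΓρ0 x))) (by linarith)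
      exact mul_nonneg (div_nonneg hCc0 (Real.sqrt_nonneg _)) this
  have ha2 : ContDiff ℝ 2 a := contDiff_energyCutoff hU2 hV2 N R
  have hah2 : ContDiff ℝ 2 ah := contDiff_energyCutoff hU2 hV2 N (2 * R)
  have hac : HasCompactSupport a := hasCompactSupport_energyCutoff hP N hR0
  have hahc : HasCompactSupport ah := hasCompactSupport_energyCutoff hP N h2R0
  have hFcc : Continuous Fc := continuous_fisherCurv δ
  have hi_lhs : Integrable fun x => smoothCutoff (ρ x / M) * |carreDuChamp vL vR a ρ x| :=
    ((((contDiff_smoothCutoff (n := 0)).continuous.comp (hρc.div_const M))).mul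
      (continuous_carreDuChamp vL vR ha2 hρ).abs).integrable_of_hasCompactSupport
      (hasCompactSupport_carreDuChamp vL vR hac ρ).abs.mul_left
  have hi1 : Integrable (sh.indicator fun x => ε * W * (ρ x + δ)) := by
    refine IntegrableOn.integrable_indicator ?_ hsh_meas
    exact (hρi.integrableOn.add (integrableOn_const (C := δ) hVsh.ne)).const_mul (ε * W)
  have hi2 : Integrable fun x => ah x * (Fc (ρ x) * Γρ x) / (2 * ε) :=
    ((hah2.continuous.mul ((hFcc.comp hρc).mul (continuous_carreDuChamp vL vR hρ hρ))).integrable_of_hasCompactSupport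
      hahc.mul_right).div_const _
  have hiΦ : Integrable Φ := (hi1.add hi2).const_mul _
  have b1 : ∫ x, sh.indicator (fun x => ε * W * (ρ x + δ)) x ≤
      ε * W * ((∫ x, ρ x) + δ * (volume {x | P.hamiltonian N x ≤ 4 * R}).toReal) := by
    rw [integral_indicator hsh_meas, integral_const_mul, integral_add hρi.integrableOn
      (integrableOn_const (C := δ) hVsh.ne), setIntegral_const, smul_eq_mul]
    have hεW : 0 ≤ ε * W := by positivity
    refine mul_le_mul_of_nonneg_left (add_le_add ?_ ?_) hεW
    · exact setIntegral_le_integral hρi (Eventually.of_forall hρ0)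
    · rw [mul_comm]
      refine mul_le_mul_of_nonneg_left ?_ hδ.le
      exact measureReal_mono hsh_sub hV4.ne
  have hfisher := half_integral_weightedFisher_le P hU hV hN hP.γ_nonneg T_L T_R hρ hρ0 hpde
    (hasDerivAt_fisherProfile δ) (hasDerivAt_fisherSlope δ) (continuous_fisherCurv δ)
    (θ := fun s => s) (ℓ := Real.pi / 2)
    (fun s hs => (fisherProfile_bounds hδ hs).1) (fun s hs => (fisherProfile_bounds hδ hs).2.1)
    (fun s hs => (fisherProfile_bounds hδ hs).2.2.1) (fun s hs => (fisherProfile_bounds hδ hs).2.2.2)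
    hρi hah2 hahc (fun x => (hah_mem x).2) (hK₁ (2 * R) h2R)
  have b2 : ∫ x, ah x * (Fc (ρ x) * Γρ x) / (2 * ε) ≤ Real.pi / 2 * (K₁ + 2 * P.γ) * (∫ x, ρ x) / ε := by
    rw [integral_div]
    have e : (∫ x, ah x * (Fc (ρ x) * Γρ x)) / (2 * ε) =
        ((1 / 2) * ∫ x, ah x * (Fc (ρ x) * Γρ x)) / ε := by
      field_simp
    rw [e]
    exact div_le_div_of_nonneg_right hfisher hε.le
  have eΦ : ∫ x, Φ x = Cc / Real.sqrt R *
      ((∫ x, sh.indicator (fun x => ε * W * (ρ x + δ)) x) + ∫ x, ah x * (Fc (ρ x) * Γρ x) / (2 * ε)) := by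
    rw [hΦ, integral_const_mul, integral_add hi1 hi2]
  calc ∫ x, smoothCutoff (ρ x / M) * |carreDuChamp vL vR a ρ x|
      ≤ ∫ x, Φ x := integral_mono hi_lhs hiΦ hpt
    _ ≤ Cc / Real.sqrt R * (ε * W * ((∫ x, ρ x) + δ * (volume {x | P.hamiltonian N x ≤ 4 * R}).toReal) +
          Real.pi / 2 * (K₁ + 2 * P.γ) * (∫ x, ρ x) / ε) := by
        rw [eΦ]
        exact mul_le_mul_of_nonneg_left (add_le_add b1 b2) (div_nonneg hCc0 (Real.sqrt_nonneg _))
    _ = _ := by rw [hCc, hW]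

include hU hV hN hTL hTR hρ hρ0 hρi hpde in
/-- **The `L¹` bound on the stationary defect of the truncations.** There are `K₀, K₃, K₄ ≥ 0` such that
for all `R ≥ 1` and `M, δ, ε > 0`, with `f = χ(H/R) m_M(ρ)`,
`∫ |L̂ f + 2γ f| ≤ K₀ ∫ θ_M(ρ) + K₃ ∫ 1_{R ≤ H} ρ + (K₄/√R)(ε (1 + arsinh²(2M/δ)) (∫ρ + δ |{H ≤ 4R}|) + ∫ρ/ε)`.
[folklore] -/
theorem integral_abs_defect_le (hP : P.IsConfining) :
    ∃ K₀ K₃ K₄ : ℝ, 0 ≤ K₀ ∧ 0 ≤ K₃ ∧ 0 ≤ K₄ ∧ ∀ (R M δ ε : ℝ), 1 ≤ R → 0 < M → 0 < δ → 0 < ε →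
      ∫ x, |sdeGenerator (fun y => -P.drift N y) (P.bathVecL N T_L) (P.bathVecR N T_R)
            (fun y => smoothCutoff (P.hamiltonian N y / R) * ∫ σ in (0:ℝ)..ρ y, smoothCutoff (σ / M)) x +
          2 * P.γ * (smoothCutoff (P.hamiltonian N x / R) * ∫ σ in (0:ℝ)..ρ x, smoothCutoff (σ / M))| ≤
        K₀ * (∫ x, (if M < ρ x then ρ x else 0)) +
        K₃ * (∫ x, {x | R ≤ P.hamiltonian N x}.indicator ρ x) +
        K₄ / Real.sqrt R * (ε * (1 + Real.arsinh (2 * M / δ) ^ 2) *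
            ((∫ x, ρ x) + δ * (volume {x | P.hamiltonian N x ≤ 4 * R}).toReal) + (∫ x, ρ x) / ε) := by
  have hU2 : ContDiff ℝ 2 P.U := hU.of_le (by norm_cast)
  have hV2 : ContDiff ℝ 2 P.V := hV.of_le (by norm_cast)
  have hγ := hP.γ_nonneg
  obtain ⟨K₁, hK₁0, hK₁⟩ := abs_generator_energyCutoff_le hU2 hV2 hP.U_nonneg hP.V_nonneg hN hγ hTL hTR
  obtain ⟨K₂, hK₂0, hK₂⟩ := abs_revGenerator_energyCutoff_le hU2 hV2 hP.U_nonneg hP.V_nonneg hN hγ hTL hTR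
  obtain ⟨C, hC0, hC⟩ := abs_fderiv_energyCutoff_bathVec_le (P := P) (N := N) hU2 hV2 hP.U_nonneg hP.V_nonneg
  set cLR := |Real.sqrt (2 * P.γ * T_L)| + |Real.sqrt (2 * P.γ * T_R)| with hcLR
  refine ⟨K₁ + 4 * P.γ, K₂, C * cLR * (1 + Real.pi / 2 * (K₁ + 2 * P.γ)), by positivity, hK₂0,
    by positivity, fun R M δ ε hR hM hδ hε => ?_⟩
  have hR0 : 0 < R := by linarith
  set vL := P.bathVecL N T_L with hvL
  set vR := P.bathVecR N T_R with hvR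
  set Lr := sdeGenerator (fun y => -P.drift N y) vL vR with hLr
  set a : PhaseSpace N → ℝ := fun y => smoothCutoff (P.hamiltonian N y / R) with ha
  set f : PhaseSpace N → ℝ := fun y => a y * ∫ σ in (0:ℝ)..ρ y, smoothCutoff (σ / M) with hf
  set m₀ := ∫ x, ρ x with hm₀
  set V := (volume {x | P.hamiltonian N x ≤ 4 * R}).toReal with hVdef
  set W := 1 + Real.arsinh (2 * M / δ) ^ 2 with hW
  have hρc : Continuous ρ := hρ.continuous
  have hYc : Continuous fun y => -P.drift N y := (P.contDiff_drift hU hV N).continuous.neg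
  have ha2 : ContDiff ℝ 2 a := contDiff_energyCutoff hU2 hV2 N R
  have hac : HasCompactSupport a := hasCompactSupport_energyCutoff hP N hR0
  have hf2 : ContDiff ℝ 2 f := contDiff_truncation hU2 hV2 hρ M R
  have hfc : HasCompactSupport f := hasCompactSupport_truncation hP M hR0
  set θ : PhaseSpace N → ℝ := fun x => if M < ρ x then ρ x else 0 with hθ
  have hθi : Integrable θ := by
    have e : θ = {x | M < ρ x}.indicator ρ := by
      funext x; simp only [hθ, Set.indicator_apply, Set.mem_setOf_eq]
    rw [e]
    exact hρi.indicator (measurableSet_lt measurable_const hρc.measurable)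
  set g2 : PhaseSpace N → ℝ := fun x => a x * (-(deriv smoothCutoff (ρ x / M) / M) *
    carreDuChamp vL vR ρ ρ x) with hg2
  have hg2i : Integrable g2 :=
    ((ha2.continuous.mul (((((contDiff_smoothCutoff (n := 1)).continuous_deriv le_rfl).comp
      (hρc.div_const M)).div_const M).neg.mul (continuous_carreDuChamp vL vR hρ hρ)))).integrable_of_hasCompactSupport
      hac.mul_right
  set g3 : PhaseSpace N → ℝ := fun x => ρ x * |Lr a x| with hg3
  have hg3i : Integrable g3 :=
    (hρc.mul (continuous_sdeGenerator _ _ hYc ha2).abs).integrable_of_hasCompactSupport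
      (hasCompactSupport_sdeGenerator _ _ hac).abs.mul_left
  set g4 : PhaseSpace N → ℝ := fun x => smoothCutoff (ρ x / M) * |carreDuChamp vL vR a ρ x| with hg4
  have hg4i : Integrable g4 :=
    ((((contDiff_smoothCutoff (n := 0)).continuous.comp (hρc.div_const M))).mul
      (continuous_carreDuChamp vL vR ha2 hρ).abs).integrable_of_hasCompactSupport
      (hasCompactSupport_carreDuChamp vL vR hac ρ).abs.mul_left
  have hEi : Integrable fun x => |Lr f x + 2 * P.γ * f x| :=
    (((continuous_sdeGenerator _ _ hYc hf2).add (continuous_const.mul hf2.continuous)).abs).integrable_of_hasCompactSupport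
      ((hasCompactSupport_sdeGenerator _ _ hfc).add (hfc.mul_left)).abs
  have hpt : ∀ x, |Lr f x + 2 * P.γ * f x| ≤ 2 * P.γ * θ x + (1 / 2) * g2 x + g3 x + g4 x := fun x =>
    abs_revGenerator_truncation_add_le hU2 hV2 hρ hpde hγ hρ0 hM R x
  have hi12 : Integrable (fun x => 2 * P.γ * θ x + 1 / 2 * g2 x) := by
    exact (hθi.const_mul (2 * P.γ)).add (hg2i.const_mul (1 / 2))
  have hi123 : Integrable (fun x => 2 * P.γ * θ x + 1 / 2 * g2 x + g3 x) := by exact hi12.add hg3i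
  have hi1234 : Integrable (fun x => 2 * P.γ * θ x + 1 / 2 * g2 x + g3 x + g4 x) := by exact hi123.add hg4i
  have hint : ∫ x, |Lr f x + 2 * P.γ * f x| ≤
      2 * P.γ * (∫ x, θ x) + (1 / 2) * (∫ x, g2 x) + (∫ x, g3 x) + ∫ x, g4 x := by
    have h := integral_mono hEi hi1234 hpt
    rw [integral_add hi123 hg4i, integral_add hi12 hg3i, integral_add (hθi.const_mul (2 * P.γ))
      (hg2i.const_mul (1 / 2)), integral_const_mul, integral_const_mul] at h
    exact h
  have b2 : (1 / 2) * ∫ x, g2 x ≤ 1 * (K₁ + 2 * P.γ) * ∫ x, θ x :=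
    half_integral_height_le hU hV hN hρ hρ0 hρi hpde hP hM hR0 (hK₁ R hR)
  have b3 : ∫ x, g3 x ≤ K₂ * ∫ x, {x | R ≤ P.hamiltonian N x}.indicator ρ x := by
    rw [← integral_const_mul]
    refine integral_mono hg3i ((hρi.indicator (measurableSet_le measurable_const
      (P.contDiff_hamiltonian hU2 hV2 N).continuous.measurable)).const_mul K₂) fun x => ?_
    exact mul_abs_revGenerator_cutoff_le hρ0 (hK₂ R hR) x
  have b4 : ∫ x, g4 x ≤ C * cLR / Real.sqrt R * (ε * W * (m₀ + δ * V) + Real.pi / 2 * (K₁ + 2 * P.γ) * m₀ / ε) :=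
    integral_cross_le hU hV hN hρ hρ0 hρi hpde hP hK₁ hC0 hC hR hM hδ hε
  have hm₀ : 0 ≤ m₀ := integral_nonneg hρ0
  have hV0 : 0 ≤ V := ENNReal.toReal_nonneg
  have hW0 : 0 ≤ W := by positivity
  have b4' : C * cLR / Real.sqrt R * (ε * W * (m₀ + δ * V) + Real.pi / 2 * (K₁ + 2 * P.γ) * m₀ / ε) ≤
      C * cLR * (1 + Real.pi / 2 * (K₁ + 2 * P.γ)) / Real.sqrt R * (ε * W * (m₀ + δ * V) + m₀ / ε) := by
    have hsq : 0 ≤ Real.sqrt R := Real.sqrt_nonneg _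
    have hCc : 0 ≤ C * cLR := by positivity
    have hq : 0 ≤ Real.pi / 2 * (K₁ + 2 * P.γ) := by positivity
    have h1 : ε * W * (m₀ + δ * V) + Real.pi / 2 * (K₁ + 2 * P.γ) * m₀ / ε ≤
        (1 + Real.pi / 2 * (K₁ + 2 * P.γ)) * (ε * W * (m₀ + δ * V) + m₀ / ε) := by
      have t1 : 0 ≤ ε * W * (m₀ + δ * V) := by positivity
      have t2 : 0 ≤ m₀ / ε := by positivity
      have e : (1 + Real.pi / 2 * (K₁ + 2 * P.γ)) * (ε * W * (m₀ + δ * V) + m₀ / ε) =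
          ε * W * (m₀ + δ * V) + Real.pi / 2 * (K₁ + 2 * P.γ) * m₀ / ε +
            (Real.pi / 2 * (K₁ + 2 * P.γ) * (ε * W * (m₀ + δ * V)) + m₀ / ε) := by ring
      rw [e]
      nlinarith [mul_nonneg hq t1]
    calc C * cLR / Real.sqrt R * (ε * W * (m₀ + δ * V) + Real.pi / 2 * (K₁ + 2 * P.γ) * m₀ / ε)
        ≤ C * cLR / Real.sqrt R * ((1 + Real.pi / 2 * (K₁ + 2 * P.γ)) * (ε * W * (m₀ + δ * V) + m₀ / ε)) :=
          mul_le_mul_of_nonneg_left h1 (div_nonneg hCc hsq)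
      _ = _ := by ring
  have e0 : 2 * P.γ * (∫ x, θ x) + 1 * (K₁ + 2 * P.γ) * (∫ x, θ x) = (K₁ + 4 * P.γ) * ∫ x, θ x := by ring
  rw [hW] at b4'
  linarith [hint, b2, b3, b4, b4', e0]

end Defect

end Summit.AtomisticToContinuum.FouriersLaw.Theorems.NessUnique

end
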